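import Literature.AlgebraicGeometry.HilbertScheme.HeisenbergFockSpace
import Literature.AlgebraicGeometry.HilbertScheme.HilbertSchemeOfPoints
import Literature.AlgebraicGeometry.Hyperkaehler.LLVGeneration
import Literature.AlgebraicGeometry.HodgeTheory.CanonicalTrace
import HarnessLib

/-!
# Nakajima's Heisenberg operators on `ℍ = ⨁ₙ H*(S^[n](ℂ); ℂ)` (hypothesis structure) and the
Nakajima–Grojnowski theorem (named fact)

Layer `Literature/AlgebraicGeometry/HilbertScheme`; sequel of `HeisenbergFockSpace` (the algebraic axioms) on
the tree's REAL carriers.  For a smooth projective complex surface `S` and its Hilbert schemes of points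
`S^[n]`, Nakajima (1997) and Grojnowski (1996) constructed operators `𝔮ₘ(α)`, `m ∈ ℤ`, `α ∈ H*(S)`, on
`ℍ = ⨁ₙ H*(S^[n])` by the incidence correspondences `Q^{[m+n,m]} ⊂ S^[m+n] × S × S^[m]`, proved the Heisenberg
(super-)commutation relations, and deduced with Göttsche's formula that `ℍ` is the irreducible highest-weight
(Fock) module generated by the vacuum `|0⟩ = 1 ∈ H⁰(S^[0])`.  The tree does not construct the correspondences;
following the tree's idiom for classical structures on real carriers (`HodgeTheory.GysinFormalism`,
`HodgeTheory.HodgeModel`) this file records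

* `HilbertSchemesOfPoints S` — a CHOICE, for every `n`, of a Hilbert scheme of `n` points `(S^[n], Ξₙ)` of `S`
  over `ℂ` in the sense of the tree's `IsHilbertSchemeOfPoints n S (S^[n]) Ξₙ`, each smooth projective of
  dimension `2n` (Fogarty's theorem, recorded as a clause exactly as in `Hyperkaehler.IsGeneralizedKummerVarietyOf`);
* `NakajimaOperators hS H` — DATA `q : ℤ → H*(S(ℂ); ℂ) →ₗ End(ℍ)` on `ℍ = fockSpace H = ⨁ₙ H*(S^[n](ℂ); ℂ)`
  subject to EXACTLY the printed properties: the axioms `IsHeisenbergRepresentation` of the prequel for the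
  Poincaré pairing `⟨α, β⟩ = ∫_S α ∪ β` (Heisenberg super-relations LQW Thm. 2.16 (i) with bracket (2.7), `𝔮₀ = 0`
  and bi-degree `(m, 2m − 2 + |α|)` Def. 2.9, vacuum `1 ∈ H⁰(S^[0](ℂ))` Def. 2.5, generation by the vacuum Lehn
  Cor. 2.6), the ADJUNCTION `𝔮₋ₘ = (−1)ᵐ 𝔮ₘ†` with respect to the Poincaré pairings of the `S^[n]` (LQW (2.12),
  Lehn Def. 2.3–2.4), and the normalisation `𝔮₁(1_S)ⁿ |0⟩ = n! · 1_{S^[n]}` (LQW p. 13);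
* the NAMED FACT `Nakajima1997_heisenberg_hilbertSchemes`: such operators exist for every smooth projective
  surface and every choice `H` (Nakajima 1997 Thm. 8.13 with the constant of Ellingsrud–Strømme, Grojnowski 1996;
  in the form printed in LQW 2002 §2 and Lehn 1999 Thm. 2.5 / Cor. 2.6).

## Sources (read; PDF pages of the materialised texts)

* W.-P. Li, Z. Qin, W. Wang, Math. Ann. 324 (2002) (arXiv:math/0009132): Def. 2.5 p. 4, (2.7) p. 4, the adjoint
  "`(𝔣(α), β) = (−1)^{m·|α|} · (α, 𝔣†(β))`" p. 4, Def. 2.9 pp. 4–5 ((2.11): "`𝔮ₙ(α)(a) = p̃₁*([Q^{[m+n,m]}] · ρ̃*α ·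
  p̃₂*a)`" for `n ≥ 0`; (2.12): "`𝔮ₙ(α) = (−1)ⁿ · 𝔮₋ₙ(α)†`" for `n < 0`; "`𝔮ₙ(α)` … of bi-degree `(n, 2n−2+|α|)`"),
  Thm. 2.16 (i) p. 5 ("`[𝔮ₙ(α), 𝔮ₘ(β)] = n · δ_{n+m} · ∫_X(αβ) · Id_ℍ` … proved by Nakajima [Na1] subject to some
  universal nonzero constant, which was determined subsequently in [ES3]"), p. 5 last paragraph ("as observed by
  Nakajima and Grojnowski … `ℍ` is an irreducible representation of the Heisenberg algebra generated by the
  `𝔮ᵢ(α)`'s with `|0⟩ ∈ H⁰(X^[0])` being the highest weight vector. In particular, a linear basis of `ℍ` is given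
  by `𝔮_{i₁}(α₁) ⋯ 𝔮_{i_k}(α_k)|0⟩`, `i₁ ≥ ⋯ ≥ i_k > 0`"), and p. 13 (proof of Lemma 5.23: "`𝔮₁(1_X)ⁿ|0⟩ = n! ·
  1_{X^[n]}`").
* M. Lehn, Invent. Math. 136 (1999) (arXiv:math/9803091): Thm. 1.1 p. 5 ("(Fogarty) `X^[n]` is a `2n`-dimensional
  irreducible smooth variety"), Def. 2.3–2.4 p. 7, Thm. 2.5 p. 8 ("`[𝔮ₙ(α), 𝔮ₘ(β)] = n · δ_{n+m} · ∫_X αβ · id_ℍ`"),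
  Cor. 2.6 p. 8 ("The action of `𝔥` on `ℍ` induces a module isomorphism `S*W₊ → ℍ`. In particular, `ℍ` is
  irreducible and generated by the vacuum vector").
* H. Nakajima, Ann. of Math. 145 (1997) 379–388, Thm. 8.13 of the book form / main theorem; I. Grojnowski, Math.
  Res. Lett. 3 (1996) 275–291 — the original sources, cited through the two printed restatements above.

## Rendering and design

* Coefficients `ℂ` (the tree's `complexBetti`, `totalCohomology ℂ`), as in every consumer of the Hodge ladder; the
  sources work over `ℚ` (the `ℂ`-statement is the base change).  `coeffFamily S i = Hⁱ(S(ℂ); ℂ)`,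
  `fockFamily H n i = Hⁱ(S^[n](ℂ); ℂ)`, so `⨁ᵢ coeffFamily S i` is `totalCohomology ℂ S(ℂ)` and
  `fockSpace H = Fock (fockFamily H)` is `⨁ₙ totalCohomology ℂ S^[n](ℂ)` on the nose.
* The pairing: `totalTraceC hX : H*(X(ℂ); ℂ) →ₗ ℂ` (the tree's canonical trace `HodgeTheory.traceC` on `H^{2 dim X}`,
  `0` elsewhere) and `poincarePairing hX (u, w) = ∫_X u ∪ w` with the tree's `totalCup`; non-degeneracy is Poincaré
  duality (the tree's `isPerfPair_cupPairing_of_field_holds`), not an axiom.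
* `NakajimaOperators` is a `Type`-valued structure (data `q` + proofs); consumers take `(𝔑 : NakajimaOperators hS H)`;
  the trust base of a result using it is the named fact below.  The structure does NOT pin `𝔮ₘ` to the
  correspondence (2.11) (no cycle classes of the `Q^{[m+n,m]}` in the tree): it asserts the printed PROPERTIES.  They
  determine `𝔮ₘ`, `m < 0`, from the `𝔮ₘ`, `m > 0` (commute to the vacuum), and the adjunction axiom ties both to the
  Poincaré pairings of the `S^[n]`; the sequel `TautologicalCupProduct` ties them to the cup products.
* SCOPE: no Chow-theoretic version (Oberdieck, Maulik–Neguț), no integral coefficients (Kapfer–Menet / Li–Qin–Wang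
  integral bases), no quasi-projective surfaces.

## Not here

The existence of the Hilbert schemes and Fogarty's theorem as facts about `IsHilbertSchemeOfPoints` (consumers take
`H : HilbertSchemesOfPoints S` as a parameter, as `IsGeneralizedKummerVarietyOf` takes its Hilbert scheme); the PBW
basis / Göttsche's formula as a theorem about `NakajimaOperators` (a consequence of the axioms and Poincaré duality);
cup products (sequel).
-/

noncomputable section

open DirectSum CategoryTheory MonoidalCategory
open Literature.AlgebraicTopology.SingularHomology
open Literature.AlgebraicGeometry.Motives (SchemeOver ComplexPoints IsSmoothProjective)
open Literature.AlgebraicGeometry.Hyperkaehler (totalCohomology ofDegree totalCup)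
open Literature.AlgebraicGeometry.HodgeTheory (complexBetti traceC)

namespace Literature.AlgebraicGeometry.HilbertScheme

/-! ### The graded trace and the Poincaré pairing on `H*(X(ℂ); ℂ)` -/

section Pairing

variable {d : ℕ} {X : SchemeOver ℂ}

/-- **The graded canonical trace** `∫_X : H*(X(ℂ); ℂ) = ⨁ₖ Hᵏ →ₗ ℂ` of a smooth projective `X` of dimension `d`:
the tree's canonical complex trace `HodgeTheory.traceC hX` on `H^{2d}(X(ℂ); ℂ)` and `0` on the other summands (the
complex analogue of `HodgeTheory.traceDeg`). [cite: Lehn1999, Def. 2.3 p. 7 ("(α, β) := ∫ αβ")] -/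
def totalTraceC (hX : IsSmoothProjective d X) : totalCohomology ℂ (ComplexPoints X) →ₗ[ℂ] ℂ :=
  DirectSum.toModule ℂ ℕ ℂ fun k ↦ if h : k = 2 * d then h ▸ traceC hX else 0

/-- On the top summand the graded trace is `∫_X`. [cite: Lehn1999, Def. 2.3 p. 7] -/
theorem totalTraceC_ofDegree_top (hX : IsSmoothProjective d X) (x : complexBetti X (2 * d)) :
    totalTraceC hX (ofDegree ℂ (ComplexPoints X) (2 * d) x) = traceC hX x := by
  simp [totalTraceC, toModule_lof]

/-- Off the top degree the graded trace vanishes. [cite: Lehn1999, Def. 2.3 p. 7] -/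
theorem totalTraceC_ofDegree_of_ne (hX : IsSmoothProjective d X) {k : ℕ} (hk : k ≠ 2 * d)
    (x : complexBetti X k) : totalTraceC hX (ofDegree ℂ (ComplexPoints X) k x) = 0 := by
  simp [totalTraceC, toModule_lof, hk]

/-- **The Poincaré pairing** `(u, w) = ∫_X u ∪ w` on `H*(X(ℂ); ℂ)` (the tree's `totalCup` followed by the graded
trace); on `H*(S)` this is LQW's "standard" non-degenerate super-symmetric bilinear form `∫_X(αβ)`, on `H*(S^[n])`
Lehn's `(α, β) := ∫_{X^[n]} αβ`. [cite: Lehn1999, Def. 2.3 p. 7] [cite: LiQinWang2002, Thm. 2.16 (i) p. 5] -/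
def poincarePairing (hX : IsSmoothProjective d X) :
    totalCohomology ℂ (ComplexPoints X) →ₗ[ℂ] totalCohomology ℂ (ComplexPoints X) →ₗ[ℂ] ℂ :=
  (totalCup ℂ (ComplexPoints X)).compr₂ (totalTraceC hX)

/-- Unfolding: `poincarePairing hX u w = ∫_X (u ∪ w)`. [cite: Lehn1999, Def. 2.3 p. 7] -/
theorem poincarePairing_apply (hX : IsSmoothProjective d X) (u w : totalCohomology ℂ (ComplexPoints X)) :
    poincarePairing hX u w = totalTraceC hX (totalCup ℂ (ComplexPoints X) u w) :=
  rfl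

end Pairing

/-! ### A choice of all Hilbert schemes of points of a surface -/

/-- **A choice of the Hilbert schemes of points `S^[n]`, `n ≥ 0`, of `S`**: for every `n` a `ℂ`-scheme `obj n`
with a universal family `fam n ⊂ S × obj n` REPRESENTING the Hilbert functor of `n` points (the tree's
`IsHilbertSchemeOfPoints`, unique up to unique isomorphism), which is smooth projective of dimension `2n` — for
`S` a smooth projective surface this clause is Fogarty's theorem ("`X^[n]` is a `2n`-dimensional irreducible smooth
variety"), recorded as a property of the witness as in `Hyperkaehler.IsGeneralizedKummerVarietyOf`.
[cite: Lehn1999, Thm. 1.1 (Fogarty) p. 5] [cite: StacksProject, Tag 0B94] -/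
structure HilbertSchemesOfPoints (S : SchemeOver ℂ) where
  /-- The scheme `S^[n]`. -/
  obj : ℕ → SchemeOver ℂ
  /-- The universal family `Ξₙ ⊂ S × S^[n]` (an ideal sheaf of `S ×_ℂ S^[n]`). -/
  fam : (n : ℕ) → (S ⊗ obj n).left.IdealSheafData
  /-- `(S^[n], Ξₙ)` represents the Hilbert functor of `n` points of `S`. -/
  isHilbertScheme : ∀ n, IsHilbertSchemeOfPoints n S (obj n) (fam n)
  /-- `S^[n]` is smooth projective (geometrically irreducible) of dimension `2n` (Fogarty). -/
  smooth : ∀ n, IsSmoothProjective (2 * n) (obj n)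

variable {S : SchemeOver ℂ}

/-- The coefficient family `i ↦ Hⁱ(S(ℂ); ℂ)`; `⨁ᵢ coeffFamily S i` is `totalCohomology ℂ S(ℂ)`.
[cite: LiQinWang2002, Def. 2.5 p. 4] -/
abbrev coeffFamily (S : SchemeOver ℂ) : ℕ → Type :=
  fun i ↦ complexBetti S i

/-- The Fock family `(n, i) ↦ ℍ^{n,i} = Hⁱ(S^[n](ℂ); ℂ)` of a choice of Hilbert schemes.
[cite: LiQinWang2002, Def. 2.5 (i) p. 4] -/
abbrev fockFamily (H : HilbertSchemesOfPoints S) : ℕ → ℕ → Type :=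
  fun n i ↦ complexBetti (H.obj n) i

/-- **`ℍ = ⨁ₙ H*(S^[n](ℂ); ℂ)`**, the Fock carrier of a choice of Hilbert schemes (`Fock (fockFamily H)`, which is
`⨁ₙ totalCohomology ℂ S^[n](ℂ)`). [cite: LiQinWang2002, Def. 2.5 (i) p. 4] [cite: Lehn1999, Def. 2.3 p. 7] -/
abbrev fockSpace (H : HilbertSchemesOfPoints S) : Type :=
  Fock (fockFamily H)

/-- **The vacuum vector** `|0⟩ = 1 ∈ H⁰(S^[0](ℂ); ℂ) ⊂ ℍ`. [cite: LiQinWang2002, Def. 2.5 (i) p. 4] -/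
def vacuumVector (H : HilbertSchemesOfPoints S) : fockSpace H :=
  Fock.of ℂ (fockFamily H) 0 0 (singularCohomology.one ℂ (ComplexPoints (H.obj 0)))

/-- The unit class `1_{S^[n]} ∈ H⁰(S^[n](ℂ); ℂ) ⊂ ℍ`. [cite: LiQinWang2002, Thm. 1.2 p. 2] -/
def unitVector (H : HilbertSchemesOfPoints S) (n : ℕ) : fockSpace H :=
  Fock.of ℂ (fockFamily H) n 0 (singularCohomology.one ℂ (ComplexPoints (H.obj n)))

/-- The unit class `1_S ∈ H⁰(S(ℂ); ℂ) ⊂ H*(S(ℂ); ℂ)` as a coefficient. [cite: LiQinWang2002, (5.6) p. 12] -/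
def unitCoeff (S : SchemeOver ℂ) : totalCohomology ℂ (ComplexPoints S) :=
  ofDegree ℂ (ComplexPoints S) 0 (singularCohomology.one ℂ (ComplexPoints S))

/-- The vacuum is the unit vector of `S^[0]`. [cite: LiQinWang2002, Def. 2.5 (i) p. 4] -/
theorem vacuumVector_eq_unitVector (H : HilbertSchemesOfPoints S) : vacuumVector H = unitVector H 0 :=
  rfl

/-- The vacuum has bi-degree `(0, 0)`. [cite: LiQinWang2002, Def. 2.5 (i) p. 4] -/
theorem vacuumVector_mem_bidegPart (H : HilbertSchemesOfPoints S) :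
    vacuumVector H ∈ bidegPart ℂ (fockFamily H) 0 0 :=
  of_mem_bidegPart (K := ℂ) (Φ := fockFamily H) 0 0 _

/-! ### Nakajima operators: the hypothesis structure -/

/-- **Nakajima's Heisenberg operators on `ℍ = ⨁ₙ H*(S^[n](ℂ); ℂ)`** for a smooth projective surface `S` and a
choice `H` of its Hilbert schemes of points: linear maps `𝔮ₘ : H*(S(ℂ); ℂ) → End(ℍ)`, `m ∈ ℤ`, such that
(i) `(𝔮, |0⟩)` satisfies the axioms `IsHeisenbergRepresentation` for the Poincaré pairing `⟨α, β⟩ = ∫_S αβ` —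
`𝔮₀ = 0`, `[𝔮ₘ(α), 𝔮ₗ(β)] = m δ_{m+l} ∫_S αβ · Id` (super-bracket), bi-degree `(m, 2m − 2 + |α|)`, vacuum
`1 ∈ H⁰(S^[0])`, `ℍ` generated by the vacuum under the creation operators; (ii) **adjunction** `𝔮₋ₘ = (−1)ᵐ 𝔮ₘ†` for the Poincaré pairings of
the `S^[n]` with the sign rule `(𝔣(x), y) = (−1)^{|𝔣||x|}(x, 𝔣†(y))`, i.e.
`∫_{S^[n+m]} 𝔮ₘ(α)(x) ∪ y = (−1)^{|α||x| + m} ∫_{S^[n]} x ∪ 𝔮₋ₘ(α)(y)` for `m > 0`; (iii) `𝔮₁(1_S)ⁿ|0⟩ = n! · 1_{S^[n]}`.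
Intended and only intended instance: the correspondence operators (2.11)–(2.12).
[cite: LiQinWang2002, Def. 2.9, (2.11)–(2.12), Thm. 2.16 (i) and p. 5 (irreducibility); p. 13 (𝔮₁(1)ⁿ|0⟩ = n!·1)]
[cite: Lehn1999, Def. 2.3–2.4, Thm. 2.5, Cor. 2.6] -/
structure NakajimaOperators (hS : IsSmoothProjective 2 S) (H : HilbertSchemesOfPoints S) where
  /-- The operators `𝔮ₘ(α)`, linear in `α ∈ H*(S(ℂ); ℂ)`. -/
  q : ℤ → totalCohomology ℂ (ComplexPoints S) →ₗ[ℂ] Module.End ℂ (fockSpace H)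
  /-- The Heisenberg axioms with respect to `∫_S αβ` and the vacuum `1 ∈ H⁰(S^[0])`. -/
  isHeisenberg :
    IsHeisenbergRepresentation (A := coeffFamily S) (Φ := fockFamily H) (poincarePairing hS) q (vacuumVector H)
  /-- Adjunction `𝔮₋ₘ = (−1)ᵐ 𝔮ₘ†`: `∫ 𝔮ₘ(α)(x) ∪ y = (−1)^{|α||x|+m} ∫ x ∪ 𝔮₋ₘ(α)(y)` (`m > 0`). -/
  adjoint : ∀ (m : ℕ), 0 < m → ∀ (i : ℕ) (a : complexBetti S i) (n j k : ℕ) (x : complexBetti (H.obj n) j)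
      (y : complexBetti (H.obj (n + m)) k),
    poincarePairing (H.smooth (n + m))
        (component ℂ ℕ (fun p ↦ FockSummand (fockFamily H) p) (n + m)
          (q m (ofDegree ℂ (ComplexPoints S) i a) (Fock.of ℂ (fockFamily H) n j x)))
        (ofDegree ℂ (ComplexPoints (H.obj (n + m))) k y) =
      (-1 : ℂ) ^ (i * j + m) *
        poincarePairing (H.smooth n) (ofDegree ℂ (ComplexPoints (H.obj n)) j x)
          (component ℂ ℕ (fun p ↦ FockSummand (fockFamily H) p) n
            (q (-(m : ℤ)) (ofDegree ℂ (ComplexPoints S) i a) (Fock.of ℂ (fockFamily H) (n + m) k y)))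
  /-- Normalisation `𝔮₁(1_S)ⁿ |0⟩ = n! · 1_{S^[n]}`. -/
  unit_pow : ∀ n : ℕ, (q 1 (unitCoeff S) ^ n) (vacuumVector H) = (n.factorial : ℂ) • unitVector H n

namespace NakajimaOperators

variable {hS : IsSmoothProjective 2 S} {H : HilbertSchemesOfPoints S}

/-- `𝔮₀ = 0`. [cite: LiQinWang2002, Def. 2.9 p. 4] -/
theorem q_zero (𝔑 : NakajimaOperators hS H) : 𝔑.q 0 = 0 :=
  𝔑.isHeisenberg.q_zero

/-- The annihilation operators kill the vacuum: `𝔮ₘ(α)|0⟩ = 0` for `m ≤ 0`. [cite: Lehn1999, §2.2 p. 8] -/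
theorem q_vacuum_eq_zero (𝔑 : NakajimaOperators hS H) {m : ℤ} (hm : m ≤ 0)
    (v : totalCohomology ℂ (ComplexPoints S)) : 𝔑.q m v (vacuumVector H) = 0 :=
  𝔑.isHeisenberg.q_apply_vac_eq_zero_of_nonpos hm v

/-- `|0⟩ = 𝔮₁(1_S)⁰|0⟩` and `1_{S^[1]} = 𝔮₁(1_S)|0⟩` (the cases `n = 0, 1` of the normalisation).
[cite: LiQinWang2002, p. 13] -/
theorem q_one_unitCoeff_vacuum (𝔑 : NakajimaOperators hS H) :
    𝔑.q 1 (unitCoeff S) (vacuumVector H) = unitVector H 1 := by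
  simpa using 𝔑.unit_pow 1

/-- Two operators on `ℍ` with the same commutators with all creation operators `𝔮ₘ(α)`, `m > 0`, and the same
value on the vacuum coincide. [cite: Lehn1999, Cor. 2.6] -/
theorem ext_of_commute (𝔑 : NakajimaOperators hS H) {T T' : Module.End ℂ (fockSpace H)}
    (hvac : T (vacuumVector H) = T' (vacuumVector H))
    (hcomm : ∀ (m : ℤ), 0 < m → ∀ (v : totalCohomology ℂ (ComplexPoints S)),
      T * 𝔑.q m v - 𝔑.q m v * T = T' * 𝔑.q m v - 𝔑.q m v * T') : T = T' :=
  𝔑.isHeisenberg.ext_of_commute hvac hcomm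

end NakajimaOperators

/-! ### The Nakajima–Grojnowski theorem (named fact) -/

/-- **Nakajima–Grojnowski: the cohomology of the Hilbert schemes of points of a smooth projective surface is the
Fock representation of the Heisenberg superalgebra of `H*(S)`.**  For every smooth projective complex surface `S`
and every choice `H` of its Hilbert schemes of points, Nakajima's operators furnish an instance of
`NakajimaOperators hS H`: "`[𝔮ₙ(α), 𝔮ₘ(β)] = n · δ_{n+m} · ∫_X(αβ) · Id_ℍ`" (Nakajima, constant by Ellingsrud–Strømme),
"`ℍ` is an irreducible representation of the Heisenberg algebra generated by the `𝔮ᵢ(α)`'s with `|0⟩ ∈ H⁰(X^[0])`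
being the highest weight vector" (Nakajima, Grojnowski), equivalently Lehn's "module isomorphism `S*W₊ → ℍ`".
EXISTENTIAL INTERFACE RENDERING: the witness is the family (2.11)–(2.12), not constructed in the tree.
[cite: Nakajima1997, Thm. 1.2 / §8 (main theorem)] [cite: Grojnowski1996, Thm. 1]
[cite: LiQinWang2002, Thm. 2.16 (i) and §2 last paragraph (p. 5)] [cite: Lehn1999, Thm. 2.5 and Cor. 2.6 (p. 8)] -/
def Nakajima1997_heisenberg_hilbertSchemes : Prop :=
  ∀ ⦃S : SchemeOver ℂ⦄ (hS : IsSmoothProjective 2 S) (H : HilbertSchemesOfPoints S), Nonempty (NakajimaOperators hS H)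

end Literature.AlgebraicGeometry.HilbertScheme

end
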